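import Summits.QuantumFields.BalabanUV.T4Continuum.Support.NE3EnergySmallFieldCurl
import HarnessLib

/-!
# T⁴ programme, node NE3, route Π, file 3b part 1 — THE REVERSE CURL READING
# `‖(d_W X)(p)‖ ≤ ‖(W e^{X})(∂p) − W(∂p)‖ + (24α(e^α − 1)(1 + 4α) + 16α²)`

NE3 formalisation swarm `b2b-balaban-t4-ne3-formalise-*`, LEAF PROVER 04 (gen 7); the owner's design note
`HOME/t4/b2b-balaban-t4-ne3-p1/g25/D-ne3p1-g25-1.md` §3 («needs the REVERSE reading of `norm_hol_vary_sub_hol_le_curl`: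
`‖curl_W X p‖ ≤ ‖(We^X)(∂p) − W(∂p)‖ + 24α(e^α−1)` — same linearisation error, to be stated») and §4 row 3b («OFFER → leaf-04-g7»);
INTENT HOME/CLAIMS.log l.22798.  Part 2 = `NE3ProductPathPlaquettes` (the moving plaquette radius of the product path).

CONTENT (all [folklore]; 0 sorry; 0 def):
§0 `one_sub_mul_exp_le_one` (`(1 − x)e^x ≤ 1`, whence `e^x − 1 ≤ xe^x`), `Ad_smul_complex`, `curlAt_lincomb` (the dressed curl of
   `a•A − b•B + E`, complex scalars);
§1 **`norm_curlAt_le_of_vary`** — for unitary `W`, skew `X` with `‖X(b)‖ ≤ α`: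
   `‖(d_W X)(p′)‖ ≤ ‖(W e^{X})(∂p′) − W(∂p′)‖ + (24α(e^α − 1)(1 + 4α) + 16α²)` (second-order Taylor of `s ↦ (W e^{sX})(∂p′)` on `[0,1]`: the
   derivative is `(d_{W e^{sX}} X)(p′)·(W e^{sX})(∂p′)` at every `s` (leaf-03's `hasDerivAt_hol_vary_at`), it moves by at most
   `6(e^α − 1)·Σ_{b⊂∂p′}‖X(b)‖ + ‖(d_W X)(p′)‖·(‖(d_W X)(p′)‖ + 6(e^α − 1)·Σ‖X(b)‖)` (NE3-R2∕leaf-03's `norm_curlAt_vary_sub_le`, leaf-03's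
   `norm_hol_vary_sub_hol_le_curl`), `Σ_{b⊂∂p′}‖X(b)‖ ≤ 4α`, and `‖(d_W X)·W(∂p′)‖ = ‖d_W X‖` up to `‖W(∂p′)⁻¹‖ ≤ 1`); the polynomial form
   **`norm_curlAt_le_of_vary_poly`** (`… + 48α²` for `α ≤ 1∕32`) and the window form **`norm_curl_le_of_radii`** (`‖(W e^{X})(∂p) − 1‖ ≤ x_A`,
   `‖W(∂p) − 1‖ ≤ x_W` ⟹ `‖(d_W X)(p)‖ ≤ x_A + x_W + 48α²`).  The extra `16α²(1 + 6(e^α−1))` against the design note's `24α(e^α−1)` is the motion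
   of the holonomy factor — second order as well.

HONEST FRAMING.  Elementary plaquette calculus on OUR frame (tree objects `hol`∕`fhol`∕`vary`∕`curlAt`∕`curl` BY NAME); nothing about Bałaban's
minimisers; `DecomposedRep`'s sizes, T-E_w♯, NE3 NOT proved; spine PROVED 0∕9; finite T⁴ rung (B)+1 — NOT infinite volume, NOT mass gap, NOT BetaPertH,
NOT Clay.  ABSOLUTE RULE kept (no printed sentence is a hypothesis; context only: [Balaban1985Averaging] (9) p. 18, (44) p. 24).
PLACEMENT: `Summits/QuantumFields/BalabanUV/`.  HONEST DEPENDENCY: continuum YM on T⁴ ⇐ BetaPertH ∧ nine spine estimates (0/9 proved);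
BetaPertH ⇐ (D1) ∧ (D4) ∧ CAP+tail; G-an2-4 gates asym, D1 and NE2/3/4.
-/

set_option autoImplicit false

open scoped BigOperators Matrix.Norms.L2Operator
open NormedSpace Finset Set

namespace Summit.QuantumFields.BalabanUV.T4Continuum.NE3CurlReverseReading

open Literature.MathematicalPhysics.QuantumFieldTheory.Balaban1983to89
open B7Prop1Explicit B7Prop2Explicit MatrixLog UnitaryModel
open T4AveragingDeficitWall (IsSkewDir IsUnitaryCfg vary vary_zero Ad curl curlAt fhol)
open AveragingDeficitTransport (mem_U1_of_unitary)
open AveragingDeficitPlaqDeriv (vary_isUnitaryCfg)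
open NE3HessBounds (norm_curlAt_le)
open NE3HessContinuity (bondL1At bondL1At_nonneg)
open NE3CurlStability (norm_curlAt_vary_sub_le)
open NE3EnergySmallFieldCurl (hasDerivAt_hol_vary_at norm_hol_vary_sub_hol_le_curl)

noncomputable section

variable {d : ℕ} {n : Type*} [Fintype n] [DecidableEq n]

/-! ## §0 Two scalar facts and the dressed curl of a linear combination -/

omit [Fintype n] [DecidableEq n] in
/-- `(1 − x)·e^x ≤ 1` — i.e. `e^x ≤ 1∕(1 − x)` for `x < 1` and `e^x − 1 ≤ x·e^x` (the tree's `AreaLaw.exp_sub_one_le_mul_exp`, kept out of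
the import cone). [folklore] -/
theorem one_sub_mul_exp_le_one (x : ℝ) : (1 - x) * Real.exp x ≤ 1 := by
  calc (1 - x) * Real.exp x ≤ Real.exp (-x) * Real.exp x := by
        gcongr; linarith [Real.add_one_le_exp (-x)]
    _ = 1 := by rw [← Real.exp_add, neg_add_cancel, Real.exp_zero]

/-- `Ad` commutes with complex scalars. [folklore] -/
theorem Ad_smul_complex (u : (Matrix n n ℂ)ˣ) (c : ℂ) (X : Matrix n n ℂ) : Ad u (c • X) = c • Ad u X := by
  simp only [Ad, Matrix.mul_smul, Matrix.smul_mul]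

/-- The dressed curl of the linear combination `a•A − b•B + E` (complex scalars). [folklore] -/
theorem curlAt_lincomb (W : Site d → Fin d → (Matrix n n ℂ)ˣ) (a b : ℂ) (A B E F : Site d → Fin d → Matrix n n ℂ)
    (h : ∀ (x : Site d) (μ : Fin d), F x μ = a • A x μ - b • B x μ + E x μ) (z : Site d) (μ ν : Fin d) :
    curlAt W F z μ ν = a • curlAt W A z μ ν - b • curlAt W B z μ ν + curlAt W E z μ ν := by
  simp only [curlAt, h, Ad, Matrix.mul_add, Matrix.add_mul, Matrix.mul_sub, Matrix.sub_mul, Matrix.mul_smul, Matrix.smul_mul,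
    smul_add, smul_sub]
  abel

/-! ## §1 The reverse curl reading -/

/-- **THE REVERSE CURL READING.**  For a unitary background `W` and a skew direction `X` with `‖X(b)‖ ≤ α`: the dressed curl at `p′ = (z; μ, ν)` is
read off the displacement of the plaquette variable along `W e^{X}` up to second order,
`‖(d_W X)(p′)‖ ≤ ‖(W e^{X})(∂p′) − W(∂p′)‖ + (24α(e^α − 1)(1 + 4α) + 16α²)`
(Taylor on `[0,1]` for `s ↦ (W e^{sX})(∂p′)`: its derivative is `(d_{W e^{sX}} X)(p′)·(W e^{sX})(∂p′)` at every `s`, and the derivative moves by at most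
`6(e^α − 1)·Σ_{b⊂∂p′}‖X(b)‖ + ‖(d_W X)(p′)‖·(‖(d_W X)(p′)‖ + 6(e^α − 1)·Σ‖X(b)‖)`, `Σ_{b⊂∂p′}‖X(b)‖ ≤ 4α`). [folklore] -/
theorem norm_curlAt_le_of_vary [Nonempty n] {W : Site d → Fin d → (Matrix n n ℂ)ˣ} (hW : IsUnitaryCfg W)
    {X : Site d → Fin d → Matrix n n ℂ} (hX : IsSkewDir X) {α : ℝ} (hXα : ∀ x κ, ‖X x κ‖ ≤ α) (z : Site d) (μ ν : Fin d) :
    ‖curlAt W X z μ ν‖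
      ≤ ‖((hol (vary W X 1) z (plaqWord μ ν) : (Matrix n n ℂ)ˣ) : Matrix n n ℂ) - ((hol W z (plaqWord μ ν) : (Matrix n n ℂ)ˣ) : Matrix n n ℂ)‖
        + (24 * α * (Real.exp α - 1) * (1 + 4 * α) + 16 * α ^ 2) := by
  set P : ℝ → Matrix n n ℂ := fun s => ((hol (vary W X s) z (plaqWord μ ν) : (Matrix n n ℂ)ˣ) : Matrix n n ℂ) with hP
  set c : Matrix n n ℂ := curlAt W X z μ ν with hc
  set P0 : Matrix n n ℂ := ((hol W z (plaqWord μ ν) : (Matrix n n ℂ)ˣ) : Matrix n n ℂ) with hP0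
  set B : ℝ := bondL1At X z μ ν with hB
  have hα0 : 0 ≤ α := (norm_nonneg _).trans (hXα z μ)
  have hB0 : 0 ≤ B := bondL1At_nonneg _ _ _ _
  have hB4 : B ≤ 4 * α := by
    rw [hB]; unfold bondL1At
    linarith [hXα z μ, hXα (z + e μ) ν, hXα (z + e ν) μ, hXα z ν]
  have hcB : ‖c‖ ≤ B := by
    rw [hc, hB]; unfold bondL1At
    exact norm_curlAt_le hW X z μ ν
  have hexp0 : 0 ≤ Real.exp α - 1 := by linarith [Real.add_one_le_exp α]
  -- the corrected path `g s = P s − s • (c * P0)` and its derivative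
  set D : ℝ := 6 * (Real.exp α - 1) * B + ‖c‖ * (‖c‖ + 6 * (Real.exp α - 1) * B) with hD
  have hderiv : ∀ s ∈ Icc (0 : ℝ) 1, HasDerivWithinAt (fun r : ℝ => P r - r • (c * P0))
      (curlAt (vary W X s) X z μ ν * P s - c * P0) (Icc (0 : ℝ) 1) s := by
    intro s _
    have h1 : HasDerivAt P (curlAt (vary W X s) X z μ ν * P s) s := by
      rw [hP]; exact hasDerivAt_hol_vary_at W X z μ ν s
    have h2 : HasDerivAt (fun r : ℝ => r • (c * P0)) ((1 : ℝ) • (c * P0)) s := (hasDerivAt_id s).smul_const _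
    rw [one_smul] at h2
    exact (h1.sub h2).hasDerivWithinAt
  have hbound : ∀ s ∈ Ico (0 : ℝ) 1, ‖curlAt (vary W X s) X z μ ν * P s - c * P0‖ ≤ D := by
    intro s hs
    have hs0 : 0 ≤ s := hs.1
    have hs1 : s ≤ 1 := hs.2.le
    -- unitarity of the moving holonomy
    have hU : ∀ y κ, vary W X s y κ ∈ U1 (Matrix n n ℂ) := fun y κ => mem_U1_of_unitary (vary_isUnitaryCfg hW hX s y κ)
    have hPs : ‖P s‖ ≤ 1 := (mem_U1.mp (hol_mem hU z (plaqWord μ ν))).1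
    -- the moving curl against the fixed one
    have hcurl := norm_curlAt_vary_sub_le hW hX hXα s X z μ ν
    rw [abs_of_nonneg hs0] at hcurl
    have hexp : Real.exp (s * α) - 1 ≤ Real.exp α - 1 := by
      have := Real.exp_le_exp.mpr (show s * α ≤ α by nlinarith)
      linarith
    have hcurl' : ‖curlAt (vary W X s) X z μ ν - c‖ ≤ 6 * (Real.exp α - 1) * B := by
      refine hcurl.trans ?_
      have := mul_le_mul_of_nonneg_right (mul_le_mul_of_nonneg_left hexp (by norm_num : (0:ℝ) ≤ 6)) hB0
      linarith
    -- the moving holonomy against the fixed one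
    have hhol := norm_hol_vary_sub_hol_le_curl hW hX hXα hs0 z μ ν
    have hhol' : ‖P s - P0‖ ≤ ‖c‖ + 6 * (Real.exp α - 1) * B := by
      have h6 : 0 ≤ ‖c‖ + 6 * (Real.exp (s * α) - 1) * B := by
        have : 0 ≤ Real.exp (s * α) - 1 := by linarith [Real.add_one_le_exp (s * α), mul_nonneg hs0 hα0]
        positivity
      calc ‖P s - P0‖ ≤ s * (‖c‖ + 6 * (Real.exp (s * α) - 1) * B) := hhol
        _ ≤ 1 * (‖c‖ + 6 * (Real.exp (s * α) - 1) * B) := mul_le_mul_of_nonneg_right hs1 h6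
        _ ≤ ‖c‖ + 6 * (Real.exp α - 1) * B := by
            rw [one_mul]
            have := mul_le_mul_of_nonneg_right (mul_le_mul_of_nonneg_left hexp (by norm_num : (0:ℝ) ≤ 6)) hB0
            linarith
    have e1 : curlAt (vary W X s) X z μ ν * P s - c * P0 = (curlAt (vary W X s) X z μ ν - c) * P s + c * (P s - P0) := by
      noncomm_ring
    rw [e1]
    calc ‖(curlAt (vary W X s) X z μ ν - c) * P s + c * (P s - P0)‖
        ≤ ‖curlAt (vary W X s) X z μ ν - c‖ * ‖P s‖ + ‖c‖ * ‖P s - P0‖ :=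
          (norm_add_le _ _).trans (add_le_add (norm_mul_le _ _) (norm_mul_le _ _))
      _ ≤ 6 * (Real.exp α - 1) * B * 1 + ‖c‖ * (‖c‖ + 6 * (Real.exp α - 1) * B) :=
          add_le_add (mul_le_mul hcurl' hPs (norm_nonneg _) (by positivity)) (mul_le_mul_of_nonneg_left hhol' (norm_nonneg _))
      _ = D := by rw [hD, mul_one]
  have hmv := norm_image_sub_le_of_norm_deriv_le_segment' hderiv hbound 1 (right_mem_Icc.mpr zero_le_one)
  -- `g 1 − g 0 = (P 1 − P 0) − c * P0`
  have e0 : P 0 = P0 := by rw [hP, hP0]; simp only [vary_zero]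
  have hmv' : ‖(P 1 - (1:ℝ) • (c * P0)) - (P 0 - (0:ℝ) • (c * P0))‖ ≤ D * (1 - 0) := hmv
  rw [one_smul, zero_smul, sub_zero, sub_zero, mul_one, e0] at hmv'
  have hmv'' : ‖P 1 - P0 - c * P0‖ ≤ D := by
    have e4 : P 1 - P0 - c * P0 = P 1 - c * P0 - P0 := by abel
    rw [e4]; exact hmv'
  -- `‖c‖ ≤ ‖c * P0‖` since `P0` is a unitary (`‖P0⁻¹‖ ≤ 1`)
  have hU0 : ∀ y κ, W y κ ∈ U1 (Matrix n n ℂ) := fun y κ => mem_U1_of_unitary (hW y κ)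
  have hP0inv : ‖(((hol W z (plaqWord μ ν))⁻¹ : (Matrix n n ℂ)ˣ) : Matrix n n ℂ)‖ ≤ 1 := (mem_U1.mp (hol_mem hU0 z (plaqWord μ ν))).2
  have hcP : ‖c‖ ≤ ‖c * P0‖ := by
    have e2 : c = (c * P0) * (((hol W z (plaqWord μ ν))⁻¹ : (Matrix n n ℂ)ˣ) : Matrix n n ℂ) := by
      rw [hP0, mul_assoc, Units.mul_inv, mul_one]
    calc ‖c‖ = ‖(c * P0) * (((hol W z (plaqWord μ ν))⁻¹ : (Matrix n n ℂ)ˣ) : Matrix n n ℂ)‖ := by rw [← e2]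
      _ ≤ ‖c * P0‖ * ‖(((hol W z (plaqWord μ ν))⁻¹ : (Matrix n n ℂ)ˣ) : Matrix n n ℂ)‖ := norm_mul_le _ _
      _ ≤ ‖c * P0‖ * 1 := mul_le_mul_of_nonneg_left hP0inv (norm_nonneg _)
      _ = ‖c * P0‖ := mul_one _
  have hcP' : ‖c * P0‖ ≤ ‖P 1 - P0‖ + D := by
    have e3 : c * P0 = (P 1 - P0) - (P 1 - P0 - c * P0) := by abel
    calc ‖c * P0‖ = ‖(P 1 - P0) - (P 1 - P0 - c * P0)‖ := by rw [← e3]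
      _ ≤ ‖P 1 - P0‖ + ‖P 1 - P0 - c * P0‖ := norm_sub_le _ _
      _ ≤ ‖P 1 - P0‖ + D := by linarith
  -- the size of `D`
  have hD' : D ≤ 24 * α * (Real.exp α - 1) * (1 + 4 * α) + 16 * α ^ 2 := by
    rw [hD]
    have hc4 : ‖c‖ ≤ 4 * α := hcB.trans hB4
    have hc0 : 0 ≤ ‖c‖ := norm_nonneg _
    have h1 : 6 * (Real.exp α - 1) * B ≤ 24 * α * (Real.exp α - 1) := by nlinarith
    have h2 : ‖c‖ * (‖c‖ + 6 * (Real.exp α - 1) * B) ≤ 4 * α * (4 * α + 24 * α * (Real.exp α - 1)) :=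
      mul_le_mul hc4 (by linarith) (by positivity) (by positivity)
    nlinarith
  linarith

/-- **POLYNOMIAL FORM** for `α ≤ 1∕32`: `‖(d_W X)(p′)‖ ≤ ‖(W e^{X})(∂p′) − W(∂p′)‖ + 48α²` (`e^α ≤ 32∕31`, `e^α − 1 ≤ αe^α`). [folklore] -/
theorem norm_curlAt_le_of_vary_poly [Nonempty n] {W : Site d → Fin d → (Matrix n n ℂ)ˣ} (hW : IsUnitaryCfg W)
    {X : Site d → Fin d → Matrix n n ℂ} (hX : IsSkewDir X) {α : ℝ} (hXα : ∀ x κ, ‖X x κ‖ ≤ α) (hα : α ≤ 1 / 32) (z : Site d)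
    (μ ν : Fin d) :
    ‖curlAt W X z μ ν‖
      ≤ ‖((hol (vary W X 1) z (plaqWord μ ν) : (Matrix n n ℂ)ˣ) : Matrix n n ℂ) - ((hol W z (plaqWord μ ν) : (Matrix n n ℂ)ˣ) : Matrix n n ℂ)‖
        + 48 * α ^ 2 := by
  have h := norm_curlAt_le_of_vary hW hX hXα z μ ν
  have hα0 : 0 ≤ α := (norm_nonneg _).trans (hXα z μ)
  have he2 : (1 - α) * Real.exp α ≤ 1 := one_sub_mul_exp_le_one α
  have he1 : Real.exp α - 1 ≤ α * Real.exp α := by nlinarith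
  have he3 : Real.exp α ≤ 32 / 31 := by nlinarith [Real.exp_pos α]
  have htail : 24 * α * (Real.exp α - 1) * (1 + 4 * α) + 16 * α ^ 2 ≤ 48 * α ^ 2 := by
    have h1 : 24 * α * (Real.exp α - 1) * (1 + 4 * α) ≤ 24 * α * (α * Real.exp α) * (1 + 4 * α) := by
      have : 0 ≤ 24 * α := by positivity
      have : 0 ≤ 1 + 4 * α := by positivity
      gcongr
    have h2 : 24 * α * (α * Real.exp α) * (1 + 4 * α) ≤ 32 * α ^ 2 := by
      have h3 : Real.exp α * (1 + 4 * α) ≤ 4 / 3 := by nlinarith [Real.exp_pos α]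
      nlinarith [sq_nonneg α, Real.exp_pos α]
    linarith
  linarith

/-- **WINDOW FORM OF THE REVERSE READING**: radii `‖(W e^{X})(∂p) − 1‖ ≤ x_A` and `‖W(∂p) − 1‖ ≤ x_W` at a plaquette give
`‖(d_W X)(p)‖ ≤ x_A + x_W + 48α²` there (`α ≤ 1∕32`). [folklore] -/
theorem norm_curl_le_of_radii [Nonempty n] {W : Site d → Fin d → (Matrix n n ℂ)ˣ} (hW : IsUnitaryCfg W)
    {X : Site d → Fin d → Matrix n n ℂ} (hX : IsSkewDir X) {α : ℝ} (hXα : ∀ x κ, ‖X x κ‖ ≤ α) (hα : α ≤ 1 / 32)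
    {xA xW : ℝ} (p : T4AveragingDeficitWall.Plaq d) (hA : ‖((fhol (vary W X 1) p : (Matrix n n ℂ)ˣ) : Matrix n n ℂ) - 1‖ ≤ xA)
    (hWp : ‖((fhol W p : (Matrix n n ℂ)ˣ) : Matrix n n ℂ) - 1‖ ≤ xW) : ‖curl W X p‖ ≤ xA + xW + 48 * α ^ 2 := by
  have h := norm_curlAt_le_of_vary_poly hW hX hXα hα p.1 p.2.1.1 p.2.1.2
  set P1 := ((hol (vary W X 1) p.1 (plaqWord p.2.1.1 p.2.1.2) : (Matrix n n ℂ)ˣ) : Matrix n n ℂ)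
  set P0 := ((hol W p.1 (plaqWord p.2.1.1 p.2.1.2) : (Matrix n n ℂ)ˣ) : Matrix n n ℂ)
  have hA' : ‖P1 - 1‖ ≤ xA := hA
  have hW' : ‖P0 - 1‖ ≤ xW := hWp
  have hd : ‖P1 - P0‖ ≤ xA + xW := by
    calc ‖P1 - P0‖ = ‖(P1 - 1) - (P0 - 1)‖ := by congr 1; abel
      _ ≤ ‖P1 - 1‖ + ‖P0 - 1‖ := norm_sub_le _ _
      _ ≤ xA + xW := add_le_add hA' hW'
  show ‖curlAt W X p.1 p.2.1.1 p.2.1.2‖ ≤ xA + xW + 48 * α ^ 2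
  linarith

end

end Summit.QuantumFields.BalabanUV.T4Continuum.NE3CurlReverseReading
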